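import Summits.QuantumFields.BalabanUV.Beta.RemainderExplicitGradient

/-!
# Beta / RemainderExplicitDivGradSymbol — BINDER-OWNERS row D4, ROAD P3 (co-owner #3, unit `b2b-balaban-beta-d4-p3`), skeleton leaf E3.3,
# THIRD THIRD, part 1 (FIBRE SIDE): the `d d*` stencil of the typed `U = 1` minimiser column as an alias sum —
# `dgMult = Σ_m ∂̂_ν(k_m) · (∂̂♭(k_m)·Â_m) · pw(k_m)(repZ z)`, its strip holomorphy, and the zero-alias symbol bound

HONEST FRAMING (page 1 of everything the β sub-cell writes): discharging `BetaPertH` makes Bałaban's UV stability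
UNCONDITIONAL — a real constructive-QFT result; it is NOT the continuum limit and NOT the Clay problem.  HONEST DEPENDENCY
(verbatim): «continuum YM on T⁴ ⇐ BetaPertH ∧ nine spine estimates (0/9 proved); BetaPertH ⇐ (D1) ∧ (D4) ∧ CAP+tail;
G-an2-4 gates asym, D1 and NE2/3/4.»  NOT IN PRINT; OUR PROOF.  `[folklore]` alias bookkeeping over the G-an2-4 swarm's fibre
currency (`GAN24.FibreDFTDictionary.boxData_inl_eq_sum`, `GAN24.FibreSymbols`, `GAN24.StripRegularPackaging.stripHolo_fibInv`,
`GAN24.StripAliasBounds.norm_dbAl_le`) and road P3's `RemainderExplicitGradient.pw_kFine_neg_zsmul` (the box wrap of a displaced point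
costs an alias-independent phase).  Companion file (same namespace): `Beta/RemainderExplicitDivGrad` — the `N⁻²`-improved strip
bound, the position-space identity `dz (codiff₁ wH) = Re latticeKernel dgMult` and the level-uniform theorem at `d + 1 = 4`.  No cited
fact, no wall binder, no `def … : Prop`; nothing about Bałaban's densities is asserted.  NOT summit progress.

ABSOLUTE RULE (cell charter, verbatim): "No internally-minted statement may enter as a cited fact. Every hypothesis is
either kernel-proved in this package or a verbatim quotation of a PUBLISHED theorem with page reference. The manuscript(s)
under audit are NOT citable for their own disputed steps — they are the thing under adjudication; programme-internal
(2001/route/tribunal) claims are never citable."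

## What is proved (generic `d`, block side `N ≥ 1`)
* §1 `repZ_proj_add` (`repZ (proj (z+v)) = repZ (proj z) + v − N•(quo(z+v) − quo z)`), `cphase_mul_pw_displaced` (the box-wrap phase
  `e^{ip·s}` turns `pw(k_m)(repZ proj(z+v))` into `pw(k_m)(v)·pw(k_m)(repZ proj z)` for EVERY alias `m`), the shifted entry `shEntry`
  and its synthesis `shEntry_eq_sum`, the stencil data `disp`/`sgn4` of `dz (codiff₁ ·) ν`, the symbol identity `sum_sgn4_pw_disp`
  (`Σ_j sgn_j pw(k)(disp_j) = ∂̂_ν(k)·∂̂♭_κ(k)`), the multiplier `dgMult` and **`dgMult_eq_sum`**.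
* §2 `stripHolo_finset_sum`, `stripHolo_shEntry`, **`stripHolo_dgMult`** (det-free strip ⇒ strip holomorphic), `norm_dbAl_zero_le`
  (`‖∂̂♭_κ(k_0)‖ ≤ (π+1)/N` on the strip, `η ≤ 1/2`).
-/

noncomputable section

open Complex Finset Matrix
open scoped BigOperators Real Matrix.Norms.L2Operator
open Literature.Probability.LatticeModels (TorusSite Torus.proj)
open Literature.MathematicalPhysics.QuantumFieldTheory.LatticeForm (quo repZ)
open Literature.MathematicalPhysics.QuantumFieldTheory.Balaban1983to89
open Literature.MathematicalPhysics.QuantumFieldTheory.Balaban1983to89.Beta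
open Literature.MathematicalPhysics.QuantumFieldTheory.King1986 (aliasConst)
open AffineAveraging (Site unitVec dz codiff₁)
open B4Strip (Strip reVec)
open B4ContourShift (BZ StripRegular latticeKernel supNorm latticeKernel_decay integrand)
open B4Green244 (phaseC latticeKernel_phase_mul latticeKernel_sum_mul)
open BlochFibreMatrix (Idx stencil pieceMatrix eq_repZ_add_zsmul_quo)
open FibreInverseDecay (trigPolySymbol StripHolo cphase stripHolo_cphase stripHolo_const)
open KernelSpecInstance (wH)
open Summit.QuantumFields.BalabanUV.Beta.GAN24.ArrowOperator (arrowMat)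
open Summit.QuantumFields.BalabanUV.Beta.GAN24.ArrowScaling (scaledArrow radI radO radI_pos radO_pos)
open Summit.QuantumFields.BalabanUV.Beta.GAN24.StripLegApriori (radO_zero_le_two_pi)
open Summit.QuantumFields.BalabanUV.Beta.GAN24.CombesThomasFibre (fibInv wH_eq_re_latticeKernel)
open Summit.QuantumFields.BalabanUV.Beta.GAN24.StripRegularPackaging (stripRegular_of_stripHolo stripHolo_fibInv)
open Summit.QuantumFields.BalabanUV.Beta.GAN24.FibreDetStripHolds (exists_strip strip_mono)
open Summit.QuantumFields.BalabanUV.Beta.GAN24.FibreSymbols (pw dhat dflat lapSym pw_add pw_add_unitVec pw_sub_unitVec)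
open Summit.QuantumFields.BalabanUV.Beta.GAN24.FibreBlockSolve (dot Asol dot_Asol)
open Summit.QuantumFields.BalabanUV.Beta.GAN24.FibreDFT (kFine pw_zero_site)
open Summit.QuantumFields.BalabanUV.Beta.GAN24.FibreDFTDictionary (ampA boxData_inl_eq_sum)
open Summit.QuantumFields.BalabanUV.Beta.GAN24.FibreArrow (dot_dflat_dhat)
open Summit.QuantumFields.BalabanUV.Beta.GAN24.AliasObjects (kAl dAl dbAl chiAl sbAl LAl)
open Summit.QuantumFields.BalabanUV.Beta.GAN24.AliasWeightsSum (lapR lapR_nonneg)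
open Summit.QuantumFields.BalabanUV.Beta.GAN24.AliasReindex (srep)
open Summit.QuantumFields.BalabanUV.Beta.GAN24.AliasWeights (kfine)
open Summit.QuantumFields.BalabanUV.Beta.GAN24.StripAliasBounds (norm_dbAl_le)
open Summit.QuantumFields.BalabanUV.Beta.GAN24.AliasPointSum (pointWeight pointWeight_nonneg sum_pointWeight_srep_le)
open Summit.QuantumFields.BalabanUV.Beta.GAN24.FineReadoutAlias (wfold Fsup wfold_nonneg one_le_Fsup lapR_pos
  half_lapR_le_norm_LAl norm_chiAl_le_prod inv_lapR_le norm_dot_le)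
open Summit.QuantumFields.BalabanUV.Beta.GAN24.FineReadoutApriori (column_apriori)
open Summit.QuantumFields.BalabanUV.Beta.GAN24.FineReadoutSum (norm_pw_repZ_le ampA_eq_Asol)
open Summit.QuantumFields.BalabanUV.Beta.GAN24.FineReadoutGradient (norm_dAl_le_Fsup norm_dAl_zero_le pointWeight_zero_eq)
open Summit.QuantumFields.BalabanUV.Beta.GAN24.FineReadoutDecay (aliasConst_nonneg)
open Summit.QuantumFields.BalabanUV.Beta.RemainderExplicitGradient (pw_kFine_neg_zsmul)

namespace Summit.QuantumFields.BalabanUV.Beta.RemainderExplicitDivGrad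

/-! ## §1 Displaced box points, the shifted column entries, and the `d d*` stencil in the fibre -/

section Algebra

variable {d N : ℕ} [NeZero N]

/-- [folklore] **THE DISPLACED BOX POINT**, any displacement `v`: `repZ (proj (z + v)) = repZ (proj z) + v − N•(quo(z + v) − quo z)`. -/
theorem repZ_proj_add (z v : Site (d + 1)) :
    repZ (Torus.proj N (z + v)) = repZ (Torus.proj N z) + v - (N : ℤ) • (quo N (z + v) - quo N z) := by
  have h1 := eq_repZ_add_zsmul_quo (N := N) (z + v)
  have h0 := eq_repZ_add_zsmul_quo (N := N) z
  have h1' : repZ (Torus.proj N (z + v)) = (z + v) - (N : ℤ) • quo N (z + v) := eq_sub_of_add_eq h1.symm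
  have h0' : z - (N : ℤ) • quo N z = repZ (Torus.proj N z) := sub_eq_of_eq_add h0
  rw [h1', smul_sub, ← h0']
  abel

/-- [folklore] **THE PHASE IDENTITY, alias by alias, any displacement**: with `s = quo(z + v) − quo z`,
`e^{i p·s} · pw(k_m)(repZ (proj (z + v))) = pw(k_m)(v) · pw(k_m)(repZ (proj z))`. -/
theorem cphase_mul_pw_displaced (p : Fin (d + 1) → ℂ) (m : TorusSite (d + 1) N) (z v : Site (d + 1)) :
    cexp (I * phaseC p (quo N (z + v) - quo N z)) * pw (kFine p m) (repZ (Torus.proj N (z + v)))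
      = pw (kFine p m) v * pw (kFine p m) (repZ (Torus.proj N z)) := by
  set s : Site (d + 1) := quo N (z + v) - quo N z with hs
  rw [repZ_proj_add z v, ← hs, sub_eq_add_neg, pw_add, pw_add, pw_kFine_neg_zsmul]
  have hcancel : cexp (I * phaseC p s) * cexp (-(I * phaseC p s)) = 1 := by
    rw [← Complex.exp_add, add_neg_cancel, Complex.exp_zero]
  calc cexp (I * phaseC p s) * (pw (kFine p m) (repZ (Torus.proj N z)) * pw (kFine p m) v * cexp (-(I * phaseC p s)))
      = (cexp (I * phaseC p s) * cexp (-(I * phaseC p s))) * (pw (kFine p m) v * pw (kFine p m) (repZ (Torus.proj N z))) := by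
        ring
    _ = pw (kFine p m) v * pw (kFine p m) (repZ (Torus.proj N z)) := by rw [hcancel, one_mul]

/-- THE SHIFTED COLUMN ENTRY with its box-wrap phase: `e^{i p·(quo(z+v) − quo z)} · fibInv (inl (κ, proj (z + v))) (inr (inr l)) p`.
Its lattice kernel at `quo z` is `wH κ l (z + v)` (§3). [folklore] -/
def shEntry (N : ℕ) [NeZero N] (κ l : Fin (d + 1)) (z v : Site (d + 1)) (p : Fin (d + 1) → ℂ) : ℂ :=
  cexp (I * phaseC p (quo N (z + v) - quo N z)) * fibInv N (Sum.inl (κ, Torus.proj N (z + v))) (Sum.inr (Sum.inr l)) p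

/-- [folklore] PLANE-WAVE SYNTHESIS OF THE SHIFTED ENTRY: `shEntry v (p) = Σ_m Â_{mκ} · pw(k_m)(v) · pw(k_m)(repZ (proj z))`. -/
theorem shEntry_eq_sum (κ l : Fin (d + 1)) (z v : Site (d + 1)) (p : Fin (d + 1) → ℂ) :
    shEntry N κ l z v p = ∑ m : TorusSite (d + 1) N,
      ampA p (fun i => fibInv N i (Sum.inr (Sum.inr l)) p) m κ * pw (kFine p m) v * pw (kFine p m) (repZ (Torus.proj N z)) := by
  unfold shEntry
  set V : Idx (d + 1) N → ℂ := fun i => fibInv N i (Sum.inr (Sum.inr l)) p with hV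
  have h1 : fibInv N (Sum.inl (κ, Torus.proj N (z + v))) (Sum.inr (Sum.inr l)) p
      = ∑ m : TorusSite (d + 1) N, ampA p V m κ * pw (kFine p m) (repZ (Torus.proj N (z + v))) :=
    boxData_inl_eq_sum p V κ _
  rw [h1, Finset.mul_sum]
  refine Finset.sum_congr rfl fun m _ => ?_
  rw [mul_assoc, ← cphase_mul_pw_displaced p m z v]
  ring

/-- The four displacements of the stencil of `dz (codiff₁ ·) ν` in the component `κ`: `e_ν − e_κ, e_ν, −e_κ, 0`. [folklore] -/
def disp (ν κ : Fin (d + 1)) : Fin 4 → Site (d + 1) := ![unitVec ν - unitVec κ, unitVec ν, -unitVec κ, 0]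

/-- Their signs `+, −, −, +`. [folklore] -/
def sgn4 : Fin 4 → ℂ := ![1, -1, -1, 1]

/-- THE `d d*` MULTIPLIER of the minimiser column `l`, component `ν`, at the fine point `z`:
`Σ_κ Σ_j sgn_j · shEntry κ l z (disp ν κ j)`. [folklore] -/
def dgMult (N : ℕ) [NeZero N] (l ν : Fin (d + 1)) (z : Site (d + 1)) (p : Fin (d + 1) → ℂ) : ℂ :=
  ∑ κ : Fin (d + 1), ∑ j : Fin 4, sgn4 j * shEntry N κ l z (disp ν κ j) p

/-- [folklore] `pw k e_ν = e^{ik_ν}`. -/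
theorem pw_unitVec (k : Fin (d + 1) → ℂ) (ν : Fin (d + 1)) : pw k (unitVec ν) = cexp (I * k ν) := by
  have h := pw_add_unitVec k 0 ν
  rwa [zero_add, pw_zero_site, mul_one] at h

/-- [folklore] `pw k (−e_κ) = e^{−ik_κ}`. -/
theorem pw_neg_unitVec (k : Fin (d + 1) → ℂ) (κ : Fin (d + 1)) : pw k (-unitVec κ) = cexp (-(I * k κ)) := by
  have h := pw_sub_unitVec k 0 κ
  rwa [zero_sub, pw_zero_site, mul_one] at h

/-- [folklore] **THE STENCIL SYMBOL**: `Σ_j sgn_j · pw(k)(disp ν κ j) = ∂̂_ν(k) · ∂̂♭_κ(k)`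
(`e^{ik_ν}e^{−ik_κ} − e^{ik_ν} − e^{−ik_κ} + 1 = (e^{ik_ν} − 1)(e^{−ik_κ} − 1)`). -/
theorem sum_sgn4_pw_disp (k : Fin (d + 1) → ℂ) (ν κ : Fin (d + 1)) :
    ∑ j : Fin 4, sgn4 j * pw k (disp ν κ j) = dhat k ν * dflat k κ := by
  rw [Fin.sum_univ_four]
  simp only [sgn4, disp, Matrix.cons_val_zero, Matrix.cons_val_one, Matrix.cons_val_two, Matrix.cons_val_three,
    Matrix.head_cons, Matrix.tail_cons]
  rw [pw_sub_unitVec, pw_unitVec, pw_neg_unitVec, pw_zero_site]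
  unfold dhat dflat
  ring

/-- [folklore] **THE `d d*` MULTIPLIER IS THE ALIAS SUM** `Σ_m ∂̂_ν(k_m) · (∂̂♭(k_m)·Â_m) · pw(k_m)(repZ (proj z))`
for the column `v = fibInv N · (inr (inr l)) p`. -/
theorem dgMult_eq_sum (l ν : Fin (d + 1)) (z : Site (d + 1)) (p : Fin (d + 1) → ℂ) :
    dgMult N l ν z p
      = ∑ m : TorusSite (d + 1) N,
          dAl N p m ν * dot (dbAl N p m) (ampA p (fun i => fibInv N i (Sum.inr (Sum.inr l)) p) m)
            * pw (kFine p m) (repZ (Torus.proj N z)) := by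
  unfold dgMult
  set V : Idx (d + 1) N → ℂ := fun i => fibInv N i (Sum.inr (Sum.inr l)) p with hV
  have hκ : ∀ κ : Fin (d + 1), ∑ j : Fin 4, sgn4 j * shEntry N κ l z (disp ν κ j) p
      = ∑ m : TorusSite (d + 1) N, ampA p V m κ * (dAl N p m ν * dbAl N p m κ) * pw (kFine p m) (repZ (Torus.proj N z)) := by
    intro κ
    have hj : ∀ j : Fin 4, sgn4 j * shEntry N κ l z (disp ν κ j) p
        = ∑ m : TorusSite (d + 1) N, sgn4 j * pw (kFine p m) (disp ν κ j) *
            (ampA p V m κ * pw (kFine p m) (repZ (Torus.proj N z))) := by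
      intro j
      rw [shEntry_eq_sum, Finset.mul_sum]
      exact Finset.sum_congr rfl fun m _ => by ring
    rw [Finset.sum_congr rfl (fun j _ => hj j), Finset.sum_comm]
    refine Finset.sum_congr rfl fun m _ => ?_
    rw [← Finset.sum_mul, sum_sgn4_pw_disp]
    show dhat (kFine p m) ν * dflat (kFine p m) κ * (ampA p V m κ * pw (kFine p m) (repZ (Torus.proj N z)))
      = ampA p V m κ * (dAl N p m ν * dbAl N p m κ) * pw (kFine p m) (repZ (Torus.proj N z))
    simp only [dAl, dbAl, kAl]
    ring
  rw [Finset.sum_congr rfl (fun κ _ => hκ κ), Finset.sum_comm]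
  refine Finset.sum_congr rfl fun m _ => ?_
  unfold dot
  rw [Finset.mul_sum, Finset.sum_mul]
  exact Finset.sum_congr rfl fun κ _ => by ring

end Algebra

/-! ## §2 The `d d*` multiplier on the strip: holomorphy and the `N⁻²`-improved bound -/

section StripBound

variable {d N : ℕ} [NeZero N]

/-- [folklore] Finite sums of strip-holomorphic multipliers are strip holomorphic. -/
theorem stripHolo_finset_sum {ι : Type*} (s : Finset ι) {G : ι → (Fin (d + 1) → ℂ) → ℂ} {κ₀ : ℝ}
    (h : ∀ i ∈ s, StripHolo (G i) κ₀) : StripHolo (fun p => ∑ i ∈ s, G i p) κ₀ := by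
  classical
  induction s using Finset.induction_on with
  | empty =>
    simp only [Finset.sum_empty]
    exact stripHolo_const 0 κ₀
  | insert a s ha ih =>
    simp only [Finset.sum_insert ha]
    exact (h a (Finset.mem_insert_self _ _)).add (ih fun i hi => h i (Finset.mem_insert_of_mem hi))

/-- [folklore] A shifted entry is strip holomorphic wherever the fibre determinant has no zero on the strip (phase · entry). -/
theorem stripHolo_shEntry {κ₀ : ℝ} (hκ : 0 ≤ κ₀)
    (hdet : ∀ p ∈ Strip (d + 1) κ₀, (trigPolySymbol (stencil (d + 1)) (pieceMatrix (N := N)) p).det ≠ 0)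
    (κ l : Fin (d + 1)) (z v : Site (d + 1)) : StripHolo (shEntry N κ l z v) κ₀ := by
  have hph : StripHolo (fun p : Fin (d + 1) → ℂ => cexp (I * phaseC p (quo N (z + v) - quo N z))) κ₀ :=
    stripHolo_cphase (quo N (z + v) - quo N z) κ₀
  exact hph.mul (stripHolo_fibInv hκ hdet (Sum.inl (κ, Torus.proj N (z + v))) (Sum.inr (Sum.inr l)))

/-- [folklore] The `d d*` multiplier is strip holomorphic wherever the fibre determinant has no zero on the strip. -/
theorem stripHolo_dgMult {κ₀ : ℝ} (hκ : 0 ≤ κ₀)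
    (hdet : ∀ p ∈ Strip (d + 1) κ₀, (trigPolySymbol (stencil (d + 1)) (pieceMatrix (N := N)) p).det ≠ 0)
    (l ν : Fin (d + 1)) (z : Site (d + 1)) : StripHolo (dgMult N l ν z) κ₀ := by
  unfold dgMult
  refine stripHolo_finset_sum _ fun κ _ => stripHolo_finset_sum _ fun j _ => ?_
  exact (stripHolo_const (sgn4 j) κ₀).mul (stripHolo_shEntry hκ hdet κ l z (disp ν κ j))

variable {p : Fin (d + 1) → ℂ} {η : ℝ}

/-- [folklore] On the zero alias (`η ≤ 1/2`): `‖∂̂♭_κ(k_0)‖ ≤ (π + 1)/N` (`k_0 = p/N`, `|sin(q/2N)| ≤ π/(2N)`, `2η/N ≤ 1/N`). -/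
theorem norm_dbAl_zero_le (hre : ∀ i, |(p i).re| ≤ π) (him : ∀ i, |(p i).im| ≤ η) (hη2 : η ≤ 1 / 2) (κ : Fin (d + 1)) :
    ‖dbAl N p (0 : TorusSite (d + 1) N) κ‖ ≤ (π + 1) / N := by
  have hN : (0 : ℝ) < N := by exact_mod_cast Nat.pos_of_ne_zero (NeZero.ne N)
  have h := norm_dbAl_le (N := N) him (by linarith) (0 : TorusSite (d + 1) N) κ
  have hk : kfine N (reVec p) (0 : TorusSite (d + 1) N) κ = reVec p κ / N := by
    unfold kfine; simp
  rw [hk] at h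
  have hsin : |Real.sin (reVec p κ / N / 2)| ≤ π / (2 * N) := by
    refine (Real.abs_sin_le_abs).trans ?_
    rw [abs_div, abs_div, abs_of_pos hN, abs_two]
    rw [div_div, le_div_iff₀ (by positivity)]
    have := hre κ
    calc |reVec p κ| / (↑N * 2) * (2 * ↑N) = |reVec p κ| := by field_simp
      _ ≤ π := this
  have hη' : 2 * (η / N) ≤ 1 / N := by
    rw [show 2 * (η / N) = (2 * η) / N by ring]
    exact div_le_div_of_nonneg_right (by linarith) hN.le
  calc ‖dbAl N p 0 κ‖ ≤ 2 * |Real.sin (reVec p κ / N / 2)| + 2 * (η / N) := h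
    _ ≤ 2 * (π / (2 * N)) + 1 / N := by linarith
    _ = (π + 1) / N := by field_simp

end StripBound

end Summit.QuantumFields.BalabanUV.Beta.RemainderExplicitDivGrad

end
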